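import Summits.QuantumFields.YangMills.Theorems.BalabanUVNodesN22W1StripLemma3
import Literature.MathematicalPhysics.QuantumFieldTheory.Balaban1983to89.T4CouplingAnalyticity

/-!
# BalabanUVNodes ∕ node N22 = NE9 — THE STRIP INDUCTION AT THE W1 OBJECT, MODULE 5: `T4OutputRate.NE9` BY NAME FOR THE W1 HISTORY FUNCTIONAL
# (bounded, non-fading moduli `4E₀∕r`) — STRIP-(1.18) at every level ⟹ W1's named predicate `T4CouplingAnalyticity.CouplingAnalytic` ⟹ NE9 by
# the tree's `ne9_of_couplingAnalytic` (Cauchy on the `r`-discs + telescoping through the hybrid histories; prefix dependence is a THEOREM of W1)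

Cell `pub-ymgap`, HUMAN RULING D-0062 (Track A), R134 ACCELERATION re-seat `pub-ymgap-dag-n22-c` (strategy s1: «the history-Lipschitz estimate
(2.40)–(2.41) p. 21 of [II] on the W1 object»), generation 2, module 5.  THEOREMS ONLY; imports module 3 `…N22W1StripLemma3` (p465262; through it
modules 1–2, generation 0's modules, S25 and the W1 OBJECT p455641) and `T4CouplingAnalyticity` (`CouplingAnalytic`, `ne9_of_couplingAnalytic` — cell
`pub-balaban` NE9 owner lineage) BY NAME.  `--supports` the K3 item of route `BalabanUVNodes`.

WHY.  Node N22's statement at a U3 bundle is `T4OutputRate.NE9 EA W κ Λ ∧ T4OutputRate.FadingMemory C₉ ω Λ` (`N22_NE9.lean` :194∕:202).  Modules 1–4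
deliver, from the ONE displayed one-step hypothesis (level T: [II] (2.15)–(2.26) per term read on the young-coupling strip) + numerals + readings in
the spaces, STRIP-(1.18) at every level in every coupling and hence ROAD 3's (A) letter, which the road-3 closers turn into `NE9 ∧ FadingMemory` with a
FADING rate `ω = θ^{1−s} < 1` GIVEN node N18's η-rate (the (O) input).  THIS MODULE records what the strip hypothesis gives BY ITSELF, with no N18 input:
the HISTORY-LIPSCHITZ ESTIMATE PROPER — `T4OutputRate.NE9` for the W1 functional with BOUNDED moduli `Λ ≡ 4E₀∕r` (Cauchy's estimate on the `r`-discs of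
STRIP, telescoping one coupling at a time through the hybrid histories inside the window, W1's prefix dependence `functionalOn_prefixDependenceOn` — a
theorem of the object — discarding the couplings `≥ j`).  This is the row's title at the object («Lipschitz dependence on the coupling history»,
`N22_NE9.lean`) modulo the displayed strip hypothesis; the moduli do NOT fade (`FadingMemory (4E₀∕r) 1 Λ` only — the located N2∕contraction content is
exactly what ROAD 3 takes from N18 instead), and it is literally the `h9` input shape `TowerCarriersBox.TowerNE9On … (4E₀∕r)` of the U3 → U6 box route
(`Spine/NE9/AnalyticBranchPropagation`: «GIVEN tower-NE5 … bounded moduli suffice (C24)»).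

WHAT.
* §1 `couplingAnalytic_functionalOn_of_stripBound` ∕ `couplingAnalytic_functional_of_stripBound` — STRIP at every level in every coupling + readings in the
  spaces ⟹ W1's named predicate `T4CouplingAnalyticity.CouplingAnalytic (W1.functionalOn S p emb) γ κ E₀ (fun _ _ => r)` (module 2's
  `supLetter_functionalOn_of_stripBound`, quantifiers reordered, `1^{age} = 1`).
* §2 `ne9_functionalOn_of_stripBound` ∕ `ne9_functional_of_stripBound` — `r > 0` ⟹ **`T4OutputRate.NE9 (W1.functionalOn S p emb) (Window γ) κ (fun _ _ => 4·E₀∕r)`**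
  (`ne9_of_couplingAnalytic` BY NAME + `W1.functionalOn_prefixDependenceOn`); `ne9_and_fadingMemory_functionalOn_of_stripBound` — with the (trivial,
  `ω = 1`) `FadingMemory (4E₀∕r) 1 (fun _ _ => 4E₀∕r)`: node N22's statement SHAPE at the object with NON-fading moduli (honest label).
* §3 END TO END FROM LEVEL T: `couplingAnalytic_functionalOn_of_termwise226Strip`, `ne9_functionalOn_of_termwise226Strip`, `ne9_functional_of_termwise226Strip`
  (module 3's `stripBound_termC_of_termwise226Strip` into §§1–2).

HONEST FRAMING.  Count-neutral by-name knit AT THE OBJECT; NOT a discharge of N22: the level-T one-step hypothesis stays DISPLAYED and asserted nowhere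
(modules 1–3 HONEST FRAMING verbatim: NOT PRINTED on the strip; inspection-level for the OLDER couplings, [H-dil] ∕ [I] p. 266–267 content for the LAST;
the W1 object is a hypothesis-schema — ref-H WATCH-W1-DEGENERATE), readings in the spaces (`hsp`) are Theorem-1 content, and the moduli obtained here do
NOT fade (the fading is ROAD 3's (O) = node N18, or ROAD 1's ω < 1 adjudication).  NE9 NOT IN PRINT; proved here ONLY modulo the displayed hypothesis;
one finite four-torus programme at fixed ε — NOT infinite volume, NOT OS on ℝ⁴, NOT a mass gap, NOT Clay.  0 `sorry`, 0 `def`, standard axioms.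

References (TYPES only): [I] = [Balaban1987RG1] T. Bałaban, Commun. Math. Phys. **109** (1987) 249–301 — §0 p. 256 (prefix dependence), (1.18) p. 263,
p. 266; [II] = [Balaban1988RG2Cluster] T. Bałaban, Commun. Math. Phys. **116** (1988) 1–22 — (2.26) p. 17, (2.38)–(2.41) pp. 20–21; the Cauchy-on-a-margin
+ telescoping step is [DimockYuan2024GNFlow] proof of Thm 4 ∕ [Dimock2015] §7 as cited in `T4CouplingAnalyticity`.
-/

noncomputable section

namespace YMDAG.N22.W1

open Set Metric
open scoped BigOperators
open Literature.MathematicalPhysics.QuantumFieldTheory.Balaban1983to89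
open Literature.MathematicalPhysics.QuantumFieldTheory.Balaban1983to89.T4Continuum (T4Family)
open Literature.MathematicalPhysics.QuantumFieldTheory.Balaban1983to89.T4OutputRate
open Literature.MathematicalPhysics.QuantumFieldTheory.Balaban1983to89.T4CouplingAnalyticity (CouplingAnalytic ne9_of_couplingAnalytic)
open Literature.MathematicalPhysics.QuantumFieldTheory.Balaban1983to89.TreeLengthTorus (TPt TDom tsys torusTreeLen torusTreeLen_nonneg)
open Literature.MathematicalPhysics.QuantumFieldTheory.Balaban1983to89.B12TreeDecay (K₀ K₀_pos)
open Literature.MathematicalPhysics.QuantumFieldTheory.Balaban1983to89.B13Lemma3TorusData (TBond)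
open Literature.MathematicalPhysics.QuantumFieldTheory.Balaban1983to89.B13Lemma3TorusTerms (terms weight)
open Literature.MathematicalPhysics.QuantumFieldTheory.Balaban1983to89.B13Lemma3TorusSocket (Lemma3Numerics)
open Literature.MathematicalPhysics.QuantumFieldTheory.Balaban1983to89.Node00
open Literature.MathematicalPhysics.QuantumFieldTheory.Balaban1983to89.Node00.Sect2 (domSys domCount CPair ofBackgroundC)
open Literature.MathematicalPhysics.QuantumFieldTheory.Balaban1983to89.Node00.W1

variable {𝔸 : Type*} {M : ℕ}

/-! ## §1 STRIP at every level ⟹ W1's named predicate `CouplingAnalytic` for the history functional -/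

/-- **STRIP AT EVERY LEVEL ⟹ `T4CouplingAnalyticity.CouplingAnalytic` FOR `W1.functionalOn S p emb`** (any frame, any reading map with readings inside
the spaces): coordinate-disc analyticity over the window with the sup letter `E₀·e^{−κ d(X)}` on sets containing the closed `r`-discs about `]0, γ]` —
the named predicate the W1 object's docstring reads by name (`Node00/HistoryTermsOfRecord` §3), from module 2's `supLetter_functionalOn_of_stripBound`
(`1^{age} = 1`, quantifiers reordered). [folklore] -/
theorem couplingAnalytic_functionalOn_of_stripBound {P : Params} (S : ClusterTower P 𝔸 M) (p : RunPairing) {B : Type} (emb : B → CPair P 𝔸)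
    (sp : (j : ℕ) → (domSys P M j).Dom → Set (CPair P 𝔸)) (hsp : ∀ (j : ℕ) (U : B) (Y : (domSys P M j).Dom), emb U ∈ sp j Y)
    {γ r E₀ κ : ℝ}
    (hall : ∀ (j : ℕ) (g : ℕ → ℝ), g ∈ Window γ → ∀ (i : ℕ) (Y : (domSys P M j).Dom) (ψ : CPair P 𝔸), ψ ∈ sp j Y →
      ∃ (Ec : ℂ → ℂ) (O : Set ℂ), IsOpen O ∧ (∀ t ∈ Ioc (0 : ℝ) γ, closedBall (t : ℂ) r ⊆ O) ∧ DifferentiableOn ℂ Ec O ∧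
        (∀ z ∈ O, ‖Ec z‖ ≤ E₀ * Real.exp (-(κ * torusTreeLen Y.1))) ∧
        (∀ t ∈ Ioc (0 : ℝ) γ, Ec t = termC S j Y (Function.update g i t) ψ)) :
    CouplingAnalytic (C := histCarriers P M p) (functionalOn S p emb) γ κ E₀ (fun _ _ => r) := by
  intro U X h hh i hi
  obtain ⟨Fz, Dset, hF, hB, hdisc, hrep⟩ := supLetter_functionalOn_of_stripBound S p emb sp hsp hall h hh U X i hi
  refine ⟨Fz, Dset, hF, fun z hz => ?_, hdisc, hrep⟩
  have h1 := hB z hz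
  rwa [one_pow, mul_one] at h1

/-- **STRIP AT EVERY LEVEL ⟹ `CouplingAnalytic` FOR THE FUNCTIONAL OF RECORD `W1.functional S ι p`** (`emb := Sect2.ofBackgroundC ι`). [folklore] -/
theorem couplingAnalytic_functional_of_stripBound {P : Params} [Ring 𝔸] (S : ClusterTower P 𝔸 M) {G : Type} [Group G] (ι : G →* 𝔸ˣ)
    (p : RunPairing) (sp : (j : ℕ) → (domSys P M j).Dom → Set (CPair P 𝔸))
    (hsp : ∀ (j : ℕ) (U : GaugeField P 0 G) (Y : (domSys P M j).Dom), ofBackgroundC ι U ∈ sp j Y) {γ r E₀ κ : ℝ}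
    (hall : ∀ (j : ℕ) (g : ℕ → ℝ), g ∈ Window γ → ∀ (i : ℕ) (Y : (domSys P M j).Dom) (ψ : CPair P 𝔸), ψ ∈ sp j Y →
      ∃ (Ec : ℂ → ℂ) (O : Set ℂ), IsOpen O ∧ (∀ t ∈ Ioc (0 : ℝ) γ, closedBall (t : ℂ) r ⊆ O) ∧ DifferentiableOn ℂ Ec O ∧
        (∀ z ∈ O, ‖Ec z‖ ≤ E₀ * Real.exp (-(κ * torusTreeLen Y.1))) ∧
        (∀ t ∈ Ioc (0 : ℝ) γ, Ec t = termC S j Y (Function.update g i t) ψ)) :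
    CouplingAnalytic (C := histCarriers P M p) (functional S ι p) γ κ E₀ (fun _ _ => r) :=
  couplingAnalytic_functionalOn_of_stripBound S p (ofBackgroundC ι) sp hsp hall

/-! ## §2 `T4OutputRate.NE9` by name for the W1 functional, bounded moduli `4E₀∕r` -/

/-- **THE HISTORY-LIPSCHITZ ESTIMATE PROPER AT THE W1 OBJECT — `T4OutputRate.NE9` BY NAME.**  STRIP at every level in every coupling + readings in the
spaces + `r > 0` ⟹ `NE9 (W1.functionalOn S p emb) (Window γ) κ (fun _ _ => 4·E₀∕r)`:
`|E^{(j)}(X; g; U) − E^{(j)}(X; g′; U)| ≤ e^{−κ d_j(X)}·Σ_{i<j} (4E₀∕r)·|g_i − g′_i|` for all window histories `g, g′` — the tree's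
`ne9_of_couplingAnalytic` (Cauchy on the `r`-discs, telescoping through the hybrid histories) on §1, with W1's prefix dependence
`functionalOn_prefixDependenceOn` (a THEOREM of the object, no hypothesis).  BOUNDED, NON-FADING moduli. [folklore] -/
theorem ne9_functionalOn_of_stripBound {P : Params} (S : ClusterTower P 𝔸 M) (p : RunPairing) {B : Type} (emb : B → CPair P 𝔸)
    (sp : (j : ℕ) → (domSys P M j).Dom → Set (CPair P 𝔸)) (hsp : ∀ (j : ℕ) (U : B) (Y : (domSys P M j).Dom), emb U ∈ sp j Y)
    {γ r E₀ κ : ℝ} (hr : 0 < r)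
    (hall : ∀ (j : ℕ) (g : ℕ → ℝ), g ∈ Window γ → ∀ (i : ℕ) (Y : (domSys P M j).Dom) (ψ : CPair P 𝔸), ψ ∈ sp j Y →
      ∃ (Ec : ℂ → ℂ) (O : Set ℂ), IsOpen O ∧ (∀ t ∈ Ioc (0 : ℝ) γ, closedBall (t : ℂ) r ⊆ O) ∧ DifferentiableOn ℂ Ec O ∧
        (∀ z ∈ O, ‖Ec z‖ ≤ E₀ * Real.exp (-(κ * torusTreeLen Y.1))) ∧
        (∀ t ∈ Ioc (0 : ℝ) γ, Ec t = termC S j Y (Function.update g i t) ψ)) :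
    NE9 (C := histCarriers P M p) (functionalOn S p emb) (Window γ) κ (fun _ _ => 4 * E₀ / r) :=
  ne9_of_couplingAnalytic (C := histCarriers P M p) (r := fun _ _ => r) (fun _ _ _ => hr) (functionalOn_prefixDependenceOn S p emb (Window γ))
    (couplingAnalytic_functionalOn_of_stripBound S p emb sp hsp hall)

/-- **`NE9` BY NAME FOR THE FUNCTIONAL OF RECORD `W1.functional S ι p`** (`emb := Sect2.ofBackgroundC ι`), bounded moduli `4E₀∕r`. [folklore] -/
theorem ne9_functional_of_stripBound {P : Params} [Ring 𝔸] (S : ClusterTower P 𝔸 M) {G : Type} [Group G] (ι : G →* 𝔸ˣ) (p : RunPairing)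
    (sp : (j : ℕ) → (domSys P M j).Dom → Set (CPair P 𝔸))
    (hsp : ∀ (j : ℕ) (U : GaugeField P 0 G) (Y : (domSys P M j).Dom), ofBackgroundC ι U ∈ sp j Y) {γ r E₀ κ : ℝ} (hr : 0 < r)
    (hall : ∀ (j : ℕ) (g : ℕ → ℝ), g ∈ Window γ → ∀ (i : ℕ) (Y : (domSys P M j).Dom) (ψ : CPair P 𝔸), ψ ∈ sp j Y →
      ∃ (Ec : ℂ → ℂ) (O : Set ℂ), IsOpen O ∧ (∀ t ∈ Ioc (0 : ℝ) γ, closedBall (t : ℂ) r ⊆ O) ∧ DifferentiableOn ℂ Ec O ∧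
        (∀ z ∈ O, ‖Ec z‖ ≤ E₀ * Real.exp (-(κ * torusTreeLen Y.1))) ∧
        (∀ t ∈ Ioc (0 : ℝ) γ, Ec t = termC S j Y (Function.update g i t) ψ)) :
    NE9 (C := histCarriers P M p) (functional S ι p) (Window γ) κ (fun _ _ => 4 * E₀ / r) :=
  ne9_functionalOn_of_stripBound S p (ofBackgroundC ι) sp hsp hr hall

/-- **NODE N22's STATEMENT SHAPE AT THE OBJECT WITH NON-FADING MODULI (honest label)**: `NE9 ∧ FadingMemory (4E₀∕r) 1 Λ` for `Λ ≡ 4E₀∕r` (`E₀ ≥ 0`,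
`r > 0`) — the `FadingMemory` conjunct at rate `ω = 1` is the triviality `0 ≤ Λ ≤ C₉·1^{k−i}`; a rate `ω < 1` is NOT obtained here (ROAD 3 takes it from
node N18; ROAD 1 from the ω < 1 adjudication).  Recorded because `TowerCarriersBox.TowerNE9On … (4E₀∕r)`-type BOUNDED moduli are what the U3 → U6 box
route reads. [folklore] -/
theorem ne9_and_fadingMemory_functionalOn_of_stripBound {P : Params} (S : ClusterTower P 𝔸 M) (p : RunPairing) {B : Type}
    (emb : B → CPair P 𝔸) (sp : (j : ℕ) → (domSys P M j).Dom → Set (CPair P 𝔸))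
    (hsp : ∀ (j : ℕ) (U : B) (Y : (domSys P M j).Dom), emb U ∈ sp j Y) {γ r E₀ κ : ℝ} (hr : 0 < r) (hE₀ : 0 ≤ E₀)
    (hall : ∀ (j : ℕ) (g : ℕ → ℝ), g ∈ Window γ → ∀ (i : ℕ) (Y : (domSys P M j).Dom) (ψ : CPair P 𝔸), ψ ∈ sp j Y →
      ∃ (Ec : ℂ → ℂ) (O : Set ℂ), IsOpen O ∧ (∀ t ∈ Ioc (0 : ℝ) γ, closedBall (t : ℂ) r ⊆ O) ∧ DifferentiableOn ℂ Ec O ∧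
        (∀ z ∈ O, ‖Ec z‖ ≤ E₀ * Real.exp (-(κ * torusTreeLen Y.1))) ∧
        (∀ t ∈ Ioc (0 : ℝ) γ, Ec t = termC S j Y (Function.update g i t) ψ)) :
    NE9 (C := histCarriers P M p) (functionalOn S p emb) (Window γ) κ (fun _ _ => 4 * E₀ / r) ∧
      FadingMemory (4 * E₀ / r) 1 (fun _ _ => 4 * E₀ / r) := by
  refine ⟨ne9_functionalOn_of_stripBound S p emb sp hsp hr hall, fun k i _ => ⟨by positivity, ?_⟩⟩
  rw [one_pow, mul_one]

/-! ## §3 End to end from the level-T strip hypothesis (module 3) -/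

variable (F : T4Family) (K : ℕ)

open Classical in
/-- **LEVEL T ⟹ `CouplingAnalytic` FOR THE W1 FUNCTIONAL** (module 3's `stripBound_termC_of_termwise226Strip` into §1). [folklore] -/
theorem couplingAnalytic_functionalOn_of_termwise226Strip [NeZero M] (S : ClusterTower (F.P K) 𝔸 M) (p : RunPairing) {B : Type}
    (emb : B → CPair (F.P K) 𝔸) (sp : (j : ℕ) → (domSys (F.P K) M j).Dom → Set (CPair (F.P K) 𝔸))
    (hsp : ∀ (j : ℕ) (U : B) (Y : (domSys (F.P K) M j).Dom), emb U ∈ sp j Y) (c : B13.Consts) {L : ℕ} [NeZero L]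
    (hL : 8 ≤ c.L) (hLc : c.L = L) {a a₂ a₂' a₅ Aabs : ℝ} (hN : Lemma3Numerics c M ((c.L : ℝ) / 2) a a₂ a₂' a₅ Aabs)
    {γ r E₀ κ r₁ : ℝ} (hr : 0 ≤ r) (hA0 : 0 ≤ c.C3act * c.ε₁) (hr₁ : 0 ≤ r₁) (hκ : κ ≤ r₁)
    (hrate : r₁ + 2 * (64 * Real.log 162) + 2 ≤ (1 - 8 * c.δ) * ((c.L : ℝ) / 2) * c.κ)
    (hsmall : c.C3act * c.ε₁ * Real.exp (5 * r₁ + 1) * K₀ 64 8 * 9 * 64 ≤ 1)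
    (hrenew : Real.exp 1 * 9 * 64 * K₀ 64 8 ^ 2 * (c.C3act * c.ε₁) ≤ E₀)
    (h226T : ∀ (k : ℕ) (g : ℕ → ℝ), g ∈ Window γ → ∀ (i : ℕ), i < k + 1 → ∀ (X : (domSys (F.P K) M (k + 1)).Dom) (φ : CPair (F.P K) 𝔸),
      φ ∈ sp (k + 1) X →
      (∀ (j : ℕ), j < k + 1 → ∀ (Y : (domSys (F.P K) M j).Dom) (ψ : CPair (F.P K) 𝔸), ψ ∈ sp j Y →
        ∃ (Ec : ℂ → ℂ) (O : Set ℂ), IsOpen O ∧ (∀ t ∈ Ioc (0 : ℝ) γ, closedBall (t : ℂ) r ⊆ O) ∧ DifferentiableOn ℂ Ec O ∧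
          (∀ z ∈ O, ‖Ec z‖ ≤ E₀ * Real.exp (-(κ * torusTreeLen Y.1))) ∧
          (∀ t ∈ Ioc (0 : ℝ) γ, Ec t = termC S j Y (Function.update g i t) ψ)) →
      ∃ (Hc : ℂ → TDom 4 (domCount (F.P K) M (k + 1)) → ℂ)
        (Tt : (Z : TDom 4 (domCount (F.P K) M (k + 1))) →
          Finset (TDom 4 (L * domCount (F.P K) M (k + 1))) × Finset (TBond 4 M (L * domCount (F.P K) M (k + 1))) → ℂ → ℂ)
        (O : Set ℂ), IsOpen O ∧ (∀ t ∈ Ioc (0 : ℝ) γ, closedBall (t : ℂ) r ⊆ O) ∧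
        (∀ Z : (domSys (F.P K) M (k + 1)).Dom, Z.1 ⊆ X.1 → DifferentiableOn ℂ (fun z => Hc z Z) O) ∧
        (∀ z ∈ O, ∀ Z : TDom 4 (domCount (F.P K) M (k + 1)), Z.1 ⊆ X.1 → ‖Hc z Z‖ ≤ ∑ t ∈ terms L M Z, ‖Tt Z t z‖) ∧
        (∀ z ∈ O, ∀ Z : TDom 4 (domCount (F.P K) M (k + 1)), Z.1 ⊆ X.1 → ∀ t ∈ terms L M Z,
          ‖Tt Z t z‖ ≤ weight L M c Z a t * Real.exp (a₅ * ((Z.1).card : ℝ))) ∧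
        (∀ t ∈ Ioc (0 : ℝ) γ, Hc t = (S k).H (restrictPrefix k (Function.update g i t)) φ)) :
    CouplingAnalytic (C := histCarriers (F.P K) M p) (functionalOn S p emb) γ κ E₀ (fun _ _ => r) :=
  couplingAnalytic_functionalOn_of_stripBound S p emb sp hsp
    (stripBound_termC_of_termwise226Strip F K S sp c hL hLc hN hr hA0 hr₁ hκ hrate hsmall hrenew h226T)

open Classical in
/-- **LEVEL T ⟹ `T4OutputRate.NE9` FOR THE W1 FUNCTIONAL, moduli `4E₀∕r`** (`r > 0`; module 3's `stripBound_termC_of_termwise226Strip` into §2).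
The history-Lipschitz estimate of the row at the object, modulo the ONE displayed one-step hypothesis of printed shape. [folklore] -/
theorem ne9_functionalOn_of_termwise226Strip [NeZero M] (S : ClusterTower (F.P K) 𝔸 M) (p : RunPairing) {B : Type}
    (emb : B → CPair (F.P K) 𝔸) (sp : (j : ℕ) → (domSys (F.P K) M j).Dom → Set (CPair (F.P K) 𝔸))
    (hsp : ∀ (j : ℕ) (U : B) (Y : (domSys (F.P K) M j).Dom), emb U ∈ sp j Y) (c : B13.Consts) {L : ℕ} [NeZero L]
    (hL : 8 ≤ c.L) (hLc : c.L = L) {a a₂ a₂' a₅ Aabs : ℝ} (hN : Lemma3Numerics c M ((c.L : ℝ) / 2) a a₂ a₂' a₅ Aabs)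
    {γ r E₀ κ r₁ : ℝ} (hr : 0 < r) (hA0 : 0 ≤ c.C3act * c.ε₁) (hr₁ : 0 ≤ r₁) (hκ : κ ≤ r₁)
    (hrate : r₁ + 2 * (64 * Real.log 162) + 2 ≤ (1 - 8 * c.δ) * ((c.L : ℝ) / 2) * c.κ)
    (hsmall : c.C3act * c.ε₁ * Real.exp (5 * r₁ + 1) * K₀ 64 8 * 9 * 64 ≤ 1)
    (hrenew : Real.exp 1 * 9 * 64 * K₀ 64 8 ^ 2 * (c.C3act * c.ε₁) ≤ E₀)
    (h226T : ∀ (k : ℕ) (g : ℕ → ℝ), g ∈ Window γ → ∀ (i : ℕ), i < k + 1 → ∀ (X : (domSys (F.P K) M (k + 1)).Dom) (φ : CPair (F.P K) 𝔸),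
      φ ∈ sp (k + 1) X →
      (∀ (j : ℕ), j < k + 1 → ∀ (Y : (domSys (F.P K) M j).Dom) (ψ : CPair (F.P K) 𝔸), ψ ∈ sp j Y →
        ∃ (Ec : ℂ → ℂ) (O : Set ℂ), IsOpen O ∧ (∀ t ∈ Ioc (0 : ℝ) γ, closedBall (t : ℂ) r ⊆ O) ∧ DifferentiableOn ℂ Ec O ∧
          (∀ z ∈ O, ‖Ec z‖ ≤ E₀ * Real.exp (-(κ * torusTreeLen Y.1))) ∧
          (∀ t ∈ Ioc (0 : ℝ) γ, Ec t = termC S j Y (Function.update g i t) ψ)) →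
      ∃ (Hc : ℂ → TDom 4 (domCount (F.P K) M (k + 1)) → ℂ)
        (Tt : (Z : TDom 4 (domCount (F.P K) M (k + 1))) →
          Finset (TDom 4 (L * domCount (F.P K) M (k + 1))) × Finset (TBond 4 M (L * domCount (F.P K) M (k + 1))) → ℂ → ℂ)
        (O : Set ℂ), IsOpen O ∧ (∀ t ∈ Ioc (0 : ℝ) γ, closedBall (t : ℂ) r ⊆ O) ∧
        (∀ Z : (domSys (F.P K) M (k + 1)).Dom, Z.1 ⊆ X.1 → DifferentiableOn ℂ (fun z => Hc z Z) O) ∧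
        (∀ z ∈ O, ∀ Z : TDom 4 (domCount (F.P K) M (k + 1)), Z.1 ⊆ X.1 → ‖Hc z Z‖ ≤ ∑ t ∈ terms L M Z, ‖Tt Z t z‖) ∧
        (∀ z ∈ O, ∀ Z : TDom 4 (domCount (F.P K) M (k + 1)), Z.1 ⊆ X.1 → ∀ t ∈ terms L M Z,
          ‖Tt Z t z‖ ≤ weight L M c Z a t * Real.exp (a₅ * ((Z.1).card : ℝ))) ∧
        (∀ t ∈ Ioc (0 : ℝ) γ, Hc t = (S k).H (restrictPrefix k (Function.update g i t)) φ)) :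
    NE9 (C := histCarriers (F.P K) M p) (functionalOn S p emb) (Window γ) κ (fun _ _ => 4 * E₀ / r) :=
  ne9_functionalOn_of_stripBound S p emb sp hsp hr
    (stripBound_termC_of_termwise226Strip F K S sp c hL hLc hN hr.le hA0 hr₁ hκ hrate hsmall hrenew h226T)

open Classical in
/-- **LEVEL T ⟹ `T4OutputRate.NE9` FOR THE FUNCTIONAL OF RECORD `W1.functional S ι p`**, moduli `4E₀∕r` (`emb := Sect2.ofBackgroundC ι`). [folklore] -/
theorem ne9_functional_of_termwise226Strip [NeZero M] [Ring 𝔸] (S : ClusterTower (F.P K) 𝔸 M) {G : Type} [Group G] (ι : G →* 𝔸ˣ)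
    (p : RunPairing) (sp : (j : ℕ) → (domSys (F.P K) M j).Dom → Set (CPair (F.P K) 𝔸))
    (hsp : ∀ (j : ℕ) (U : GaugeField (F.P K) 0 G) (Y : (domSys (F.P K) M j).Dom), ofBackgroundC ι U ∈ sp j Y) (c : B13.Consts)
    {L : ℕ} [NeZero L] (hL : 8 ≤ c.L) (hLc : c.L = L) {a a₂ a₂' a₅ Aabs : ℝ} (hN : Lemma3Numerics c M ((c.L : ℝ) / 2) a a₂ a₂' a₅ Aabs)
    {γ r E₀ κ r₁ : ℝ} (hr : 0 < r) (hA0 : 0 ≤ c.C3act * c.ε₁) (hr₁ : 0 ≤ r₁) (hκ : κ ≤ r₁)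
    (hrate : r₁ + 2 * (64 * Real.log 162) + 2 ≤ (1 - 8 * c.δ) * ((c.L : ℝ) / 2) * c.κ)
    (hsmall : c.C3act * c.ε₁ * Real.exp (5 * r₁ + 1) * K₀ 64 8 * 9 * 64 ≤ 1)
    (hrenew : Real.exp 1 * 9 * 64 * K₀ 64 8 ^ 2 * (c.C3act * c.ε₁) ≤ E₀)
    (h226T : ∀ (k : ℕ) (g : ℕ → ℝ), g ∈ Window γ → ∀ (i : ℕ), i < k + 1 → ∀ (X : (domSys (F.P K) M (k + 1)).Dom) (φ : CPair (F.P K) 𝔸),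
      φ ∈ sp (k + 1) X →
      (∀ (j : ℕ), j < k + 1 → ∀ (Y : (domSys (F.P K) M j).Dom) (ψ : CPair (F.P K) 𝔸), ψ ∈ sp j Y →
        ∃ (Ec : ℂ → ℂ) (O : Set ℂ), IsOpen O ∧ (∀ t ∈ Ioc (0 : ℝ) γ, closedBall (t : ℂ) r ⊆ O) ∧ DifferentiableOn ℂ Ec O ∧
          (∀ z ∈ O, ‖Ec z‖ ≤ E₀ * Real.exp (-(κ * torusTreeLen Y.1))) ∧
          (∀ t ∈ Ioc (0 : ℝ) γ, Ec t = termC S j Y (Function.update g i t) ψ)) →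
      ∃ (Hc : ℂ → TDom 4 (domCount (F.P K) M (k + 1)) → ℂ)
        (Tt : (Z : TDom 4 (domCount (F.P K) M (k + 1))) →
          Finset (TDom 4 (L * domCount (F.P K) M (k + 1))) × Finset (TBond 4 M (L * domCount (F.P K) M (k + 1))) → ℂ → ℂ)
        (O : Set ℂ), IsOpen O ∧ (∀ t ∈ Ioc (0 : ℝ) γ, closedBall (t : ℂ) r ⊆ O) ∧
        (∀ Z : (domSys (F.P K) M (k + 1)).Dom, Z.1 ⊆ X.1 → DifferentiableOn ℂ (fun z => Hc z Z) O) ∧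
        (∀ z ∈ O, ∀ Z : TDom 4 (domCount (F.P K) M (k + 1)), Z.1 ⊆ X.1 → ‖Hc z Z‖ ≤ ∑ t ∈ terms L M Z, ‖Tt Z t z‖) ∧
        (∀ z ∈ O, ∀ Z : TDom 4 (domCount (F.P K) M (k + 1)), Z.1 ⊆ X.1 → ∀ t ∈ terms L M Z,
          ‖Tt Z t z‖ ≤ weight L M c Z a t * Real.exp (a₅ * ((Z.1).card : ℝ))) ∧
        (∀ t ∈ Ioc (0 : ℝ) γ, Hc t = (S k).H (restrictPrefix k (Function.update g i t)) φ)) :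
    NE9 (C := histCarriers (F.P K) M p) (functional S ι p) (Window γ) κ (fun _ _ => 4 * E₀ / r) :=
  ne9_functionalOn_of_termwise226Strip F K S p (ofBackgroundC ι) sp hsp c hL hLc hN hr hA0 hr₁ hκ hrate hsmall hrenew h226T

end YMDAG.N22.W1

end
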